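import Literature.MathematicalPhysics.QuantumFieldTheory.Balaban1983to89.B8Prop6CubeMemberGauged
import Literature.MathematicalPhysics.QuantumFieldTheory.Balaban1983to89.B8Prop6CubeMemberNormsFlat
import Literature.MathematicalPhysics.QuantumFieldTheory.Balaban1983to89.B8Prop6CubeMemberFlat3

/-!
# `Balaban1983to89.B8Prop6CubeMemberGaugedFlat` — [Balaban1985RegularSpaces] PROPOSITION 6 (p. 99) (1.135)–(1.138) AS `Node00.GaugedBoundB8`
# AND `B8.Prop6Printed` ON `Node00.zdCub`, IN THE FLAT CURRENCY: Theorem 4's three existence inputs at the flat datum `(1, U₀″)` and Proposition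
# 3's (1.59) input for `G(1)` — the weakest honest hypotheses for the knit's `p6` slot

statement-level skeleton of published theorems with citation tags; proofs where landed; nothing here is a claim about the
Yang–Mills mass gap

T. Bałaban, *Spaces of regular gauge field configurations on a lattice and gauge fixing conditions*, Commun. Math. Phys. **99**
(1985) 75–102 `[Balaban1985RegularSpaces]` ("B8"), Sect. F pp. 98–99 (Proposition 6, (1.131)–(1.138)), Theorem 4 p. 88, Proposition 3 p. 87,
Proposition 5 p. 94, (1.59) p. 86.  PDF held: `paper:balaban1985-cmp99-regular-spaces-gauge-fixing` (journal page = PDF page + 74).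

CITATION HEADER (lean-in-tree rule).  Cell `pub-ymgap` (YM Track A, HUMAN RULING D-0062), DAG node N05 = [B8], seat `pub-ymgap-dag-n05-e`
(g2; director-ym R141 (C), FAN-OUT §N05 row s3b successor — THE FLAT CURRENCY for Proposition 6).  This seat's g0 ∕ g2 modules
`B8Prop6CubeMemberGauged` ∕ `B8LeafKnitZd3Cub` give the knit's `p6` letter `B8.Prop6Printed d L (5dLB₀) c₁ (zdCub ∘ f)` modulo per-cube SOCKETS
quantified over EVERY background `U₀ ∈ 𝔄_k({□_j}, ·)` ([4] Thms 3.1–3.3 at curved backgrounds on a finite Dirichlet region).  Print applies Theorem 4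
«for the pair of configurations 1, U₀″» and Proposition 3 «without any external gauge field configuration» (p. 99).  THIS FILE re-runs the g0
packaging on the flat inputs: **`gaugedBoundB8_cubeMember_flat₃`** — (1.135)–(1.138) as `Node00.GaugedBoundB8 L η U₀ c (7dL²·5dLB₀·M·α₀)` at every
cube `c`, from (i) the (1.59) body for `G(1)` on the cube family (`B8Prop6CubeMemberNormsFlat.norms136_cubeMember_printed_flat`) and (ii) Theorem 4's
three existence inputs at the flat datum `(1, U₀″)` — Proposition 5's fixed point at the base level and at every intermediate level over `(1, U₀″)`,
(1.59) for the fields gauge-related to `U₀″` over `1` (`B8Prop6CubeMemberFlat3.prop6_exists_cubeMember_at₃` on `B8Thm4ExistsAt.thm4Exists_concrete_at`);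
**`prop6Printed_zdCub_flat₃`** — `B8.Prop6Printed d L (5dLB₀) c₁ (zdCub ∘ f)` from those inputs at every cube of every `f j` and every admissible
`(U₀, α₀)` (the cube's `U₀` enters Theorem 4 only through the PERTURBATION `U₀″` of the flat pair).  ONE threshold `c₁ > 0` chosen before `η`, the
cube and `f`.

HONEST SCOPE.  Packaging BY NAME; the four displayed flat inputs are NOT discharged (their content: Proposition 5 at background `1` = the letters
`G′(1)`, `H′(1)`, `C(1)` of Sects. C–E on the finite cube with (1.92)∕(1.98)∕(1.101) uniform in `k, η, M`, and [4] Thm 3.3 for `G(1)` — FLAT multi-level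
estimates, in the tree on torus ∕ [B6] box carriers only; the `ℤᵈ`-cube dictionary is NOT in the tree, size XL); HONEST SCOPE of
`B8Prop6CubeMemberGauged` applies verbatim (`GaugedBoundB8`'s (1.136) = sup members, non-strict `≤`, `B₁ = 5dLB₀`).  Count-neutral; N05 NOT
discharged; one finite `T⁴` programme at fixed `ε`, Bałaban as printed; nothing continuum ∕ ℝ⁴ ∕ OS ∕ mass-gap ∕ Clay.  No `sorry`, no `def`, no
`instance`, no `notation`.  Unit `pub-ymgap-dag-n05-e` (g2), 2026-08-26.
-/

noncomputable section

open NormedSpace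

namespace Literature.MathematicalPhysics.QuantumFieldTheory.Balaban1983to89.B8Prop6CubeMemberGaugedFlat

open MatrixLog B7Prop1Explicit B7Prop2Explicit B7Prop1Local B7Eq92Concrete
open B7Prop3Flat (c3)
open B7Prop4GeneralLevels (logCovIter linCovIter)
open B8Ineq132 (covDerivFwd InAk)
open B8Ineq133 (cutFixed)
open B8Lemma1NonAbelian (mulCfg)
open B8Eq115GaugeFixing (localGauge gaugeAct_mem_of)
open B8Eq119TwistedAxial (InAx Restr129)
open B8Eq140Level (SideTouches)
open B8Eq143PlaqExpansion (pdiv)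
open B8Eq146AExpansion (iEta plaqCovDeriv)
open B8Eq155JBound (Jcur wsup)
open B8ScaledSupNorm (bondNorm msup)
open B8Eq184Proof (gaugeExp cfgExp)
open B8Eq138LandauZd (IsLandau138W logCfg covLap)
open B8Eq131Cubes (tcube tLo tHi ctr)
open B8Eq131CubesAdmissible (cubeFam)
open B8CubeMemberZd (cubeLamS cubeLamB)
open B8Prop6OfThm4 (const_136 smallness_134)
open B8LeafModelZd (ZdIdx)
open B9Eq340HolderZd (hquot AdmPair)
open B8Prop6CubeMemberNormsAt (windows136_of_small)
open B8Prop6CubeMemberNormsFlat (norms136_cubeMember_printed_flat)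
open B8Prop6CubeMemberFlat3 (prop6_exists_cubeMember_at₃)
open B8Prop6CubeMemberGauged (gaugedBoundB8_of_clauses)
open Node00 (CubeB8 GaugedBoundB8 zdCub prop6Printed_zdCub_iff)

-- `Site` alone could resolve to the torus sites of `Setup.lean`; re-export the `ℤ^d` sites of `B7Prop1Explicit`.
export B7Prop1Explicit (Site)

variable {d : ℕ}

variable {𝔸 : Type} [CStarAlgebra 𝔸] [Nontrivial 𝔸]

/-! ## §1 (1.135)–(1.138) at every cube from the flat inputs -/

/-- **PROPOSITION 6 (p. 99), (1.135)–(1.138) AS `GaugedBoundB8` AT EVERY CUBE, FLAT CURRENCY** — `B8Prop6CubeMemberGauged.gaugedBoundB8_cubeMember₃`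
with the per-cube sockets replaced by the FLAT inputs print uses: the (1.59) body for `G(1)` on the cube family (Prop. 3 at background `1`) and,
for the given `(U₀, α₀)`, Theorem 4's three existence inputs at the pair `(1, U₀″)`.  ONE threshold `c₁(d, L, B₀, B₀′, B₀β, C₂, c_{B9}, β, len) > 0`;
`B₁ = 5dLB₀`. [cite: Balaban1985RegularSpaces, Prop. 6 (1.135)–(1.138) p.99 («for the pair 1, U₀″»; «the configuration is equal to 1»), Thm 4 p.88 (existence), Prop. 3 p.87, Prop. 5 (1.107)–(1.108) p.94, (1.59) p.86] -/
theorem gaugedBoundB8_cubeMember_flat₃ (hd2 : 2 ≤ d) {L : ℕ} (hL : 2 ≤ L) {B₀ B₀' B₀β C₂ cB9 : ℝ} (hB₀ : 0 < B₀)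
    (hB₀' : 0 < B₀') (hB : 2 ≤ 5 * (d : ℝ) * L * B₀) (hB₀β : 0 ≤ B₀β) (hC₂ : 2097152 * ((d : ℝ) + 1) ^ 2 ≤ C₂) (hcB9 : 0 < cB9)
    (β : ℝ) (len : Site d → ℝ) :
    ∃ c₁ : ℝ, 0 < c₁ ∧ ∀ (η : ℝ), 0 < η → ∀ {K : ℕ} {Ω : ℕ → Set (Site d)} (c : CubeB8 d L K Ω),
      -- (1.59) for `G(1)` on the cube family (Prop. 3's input at background 1)
      (∀ α₀' α₂ : ℝ, 0 < α₀' → α₀' ≤ cB9 → 0 < α₂ → α₂ ≤ cB9 →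
        ∀ (W : Site d → Fin d → 𝔸ˣ), (∀ x κ, W x κ ∈ unitaryUnits 𝔸) →
        InAk L c.k η α₀' (cubeFam false L c.a c.M c.ρ c.k) (1 : Site d → Fin d → 𝔸ˣ) → InAk L c.k η α₀' (cubeFam false L c.a c.M c.ρ c.k) (mulCfg W (1 : Site d → Fin d → 𝔸ˣ)) →
        IsLandau138W L c.k η (cubeFam false L c.a c.M c.ρ c.k 0) (cubeLamS L c.a c.M c.ρ c.k c.k) (1 : Site d → Fin d → 𝔸ˣ) W →
        ∀ A' : Site d → Fin d → 𝔸, (∀ y τ, IsSelfAdjoint (A' y τ)) →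
        (∀ j, j ≤ c.k → ∀ (y : Site d) (τ : Fin d), SideTouches (cubeFam false L c.a c.M c.ρ c.k j) y τ →
          W y τ = cfgExp η A' y τ ∧ ‖A' y τ‖ ≤ α₂ * ((L : ℝ) ^ j * η)⁻¹) →
        (∀ (y : Site d) (τ : Fin d), (∀ j, j ≤ c.k → ¬ SideTouches (cubeFam false L c.a c.M c.ρ c.k j) y τ) → A' y τ = 0) →
        msup L c.k η (-(1 : ℝ)) (fun j (b : Site d × Fin d) => SideTouches (cubeFam false L c.a c.M c.ρ c.k j) b.1 b.2) (fun b => A' b.1 b.2)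
            ≤ B₀ * (bondNorm L c.k η (-(3 : ℝ)) (cubeFam false L c.a c.M c.ρ c.k) (fun x μ => Jcur η (1 : Site d → Fin d → 𝔸ˣ) A' μ x)
              + wsup 1 (fun p : {p : ℕ × (Site d × Fin d) // p.1 ≤ c.k ∧ p.2 ∈ cubeLamB L c.a c.M c.ρ c.k c.k p.1} =>
                  linCovIter L (1 : Site d → Fin d → 𝔸ˣ) (iEta η A') p.1.1 p.1.2.1 p.1.2.2)) ∧
          msup L c.k η (-(2 : ℝ)) (fun j (t : Fin d × Fin d × Site d) => SideTouches (cubeFam false L c.a c.M c.ρ c.k j) t.2.2 t.2.1)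
              (fun t => covDerivFwd η (1 : Site d → Fin d → 𝔸ˣ) t.1 (fun z => A' z t.2.1) t.2.2)
            ≤ B₀ * (bondNorm L c.k η (-(3 : ℝ)) (cubeFam false L c.a c.M c.ρ c.k) (fun x μ => Jcur η (1 : Site d → Fin d → 𝔸ˣ) A' μ x)
              + wsup 1 (fun p : {p : ℕ × (Site d × Fin d) // p.1 ≤ c.k ∧ p.2 ∈ cubeLamB L c.a c.M c.ρ c.k c.k p.1} =>
                  linCovIter L (1 : Site d → Fin d → 𝔸ˣ) (iEta η A') p.1.1 p.1.2.1 p.1.2.2)) ∧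
          bondNorm L c.k η (-(3 : ℝ)) (cubeFam false L c.a c.M c.ρ c.k) (fun x μ => pdiv η (1 : Site d → Fin d → 𝔸ˣ) (plaqCovDeriv η (1 : Site d → Fin d → 𝔸ˣ) A') μ x)
            ≤ B₀ * (bondNorm L c.k η (-(3 : ℝ)) (cubeFam false L c.a c.M c.ρ c.k) (fun x μ => Jcur η (1 : Site d → Fin d → 𝔸ˣ) A' μ x)
              + wsup 1 (fun p : {p : ℕ × (Site d × Fin d) // p.1 ≤ c.k ∧ p.2 ∈ cubeLamB L c.a c.M c.ρ c.k c.k p.1} =>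
                  linCovIter L (1 : Site d → Fin d → 𝔸ˣ) (iEta η A') p.1.1 p.1.2.1 p.1.2.2)) ∧
          bondNorm L c.k η (-(3 : ℝ)) (cubeFam false L c.a c.M c.ρ c.k) (fun x μ => covLap η (1 : Site d → Fin d → 𝔸ˣ) (fun z => A' z μ) x)
            ≤ B₀ * (bondNorm L c.k η (-(3 : ℝ)) (cubeFam false L c.a c.M c.ρ c.k) (fun x μ => Jcur η (1 : Site d → Fin d → 𝔸ˣ) A' μ x)
              + wsup 1 (fun p : {p : ℕ × (Site d × Fin d) // p.1 ≤ c.k ∧ p.2 ∈ cubeLamB L c.a c.M c.ρ c.k c.k p.1} =>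
                  linCovIter L (1 : Site d → Fin d → 𝔸ˣ) (iEta η A') p.1.1 p.1.2.1 p.1.2.2)) ∧
          msup L c.k η (-(2 + β)) (fun j (q : Fin d × Fin d × (Site d × Site d)) => q.2.2 ∈ AdmPair η len ∧ q.2.2.1 ∈ cubeFam false L c.a c.M c.ρ c.k j)
              (fun q => hquot η β len (1 : Site d → Fin d → 𝔸ˣ) (covDerivFwd η (1 : Site d → Fin d → 𝔸ˣ) q.1 (fun z => A' z q.2.1)) q.2.2)
            ≤ B₀β * (bondNorm L c.k η (-(3 : ℝ)) (cubeFam false L c.a c.M c.ρ c.k) (fun x μ => Jcur η (1 : Site d → Fin d → 𝔸ˣ) A' μ x)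
              + wsup 1 (fun p : {p : ℕ × (Site d × Fin d) // p.1 ≤ c.k ∧ p.2 ∈ cubeLamB L c.a c.M c.ρ c.k c.k p.1} =>
                  linCovIter L (1 : Site d → Fin d → 𝔸ˣ) (iEta η A') p.1.1 p.1.2.1 p.1.2.2))) →
      ∀ (U₀ : Site d → Fin d → 𝔸ˣ), (∀ x κ, U₀ x κ ∈ unitaryUnits 𝔸) → ∀ (α₀ : ℝ), 0 < α₀ → InAk L K η α₀ Ω U₀ →
      7 * d * (L : ℝ) ^ 2 * c.M * α₀ ≤ c₁ →
      -- Theorem 4's three existence inputs at the flat datum `(1, U₀″)`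
      ((∃ (v : Site d → 𝔸ˣ) (lam : Site d → 𝔸), (∀ x, v x ∈ unitaryUnits 𝔸) ∧ (∀ x, x ∉ (cubeFam false L c.a c.M c.ρ c.k) 0 → v x = 1) ∧
        (∀ j, j ≤ 1 → ∀ b ∈ {b : Site d × Fin d | SideTouches ((cubeFam false L c.a c.M c.ρ c.k) j) b.1 b.2}, (v b.1 : 𝔸) = ((gaugeExp lam b.1 : 𝔸ˣ) : 𝔸) ∧
        (v (b.1 + e b.2) : 𝔸) = ((gaugeExp lam (b.1 + e b.2) : 𝔸ˣ) : 𝔸)) ∧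
        (∀ j, j ≤ 1 → ∀ b ∈ {b : Site d × Fin d | SideTouches ((cubeFam false L c.a c.M c.ρ c.k) j) b.1 b.2},
        ‖lam b.1‖ ≤ (8 * B₀' * (5 * (d : ℝ) * L * B₀) * (((L : ℝ) ^ 3 * α₀) + (6 * d * (L : ℝ) ^ 2 * c.M * α₀))) ∧
          ((L : ℝ) ^ j * η) * ‖covDerivFwd η (1 : Site d → Fin d →
          𝔸ˣ) b.2 lam b.1‖ ≤ (8 * B₀' * (5 * (d : ℝ) * L * B₀) * (((L : ℝ) ^ 3 * α₀) + (6 * d * (L : ℝ) ^ 2 * c.M * α₀)))) ∧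
        IsLandau138W L 1 η ((cubeFam false L c.a c.M c.ρ c.k) 0) ((cubeLamS L c.a c.M c.ρ c.k) 1) (1 : Site d → Fin d → 𝔸ˣ) (mgauge (1 : Site d → Fin d →
          𝔸ˣ) v⁻¹ (cutFixed L (tLo c.a c.ρ) (tHi c.a c.M c.ρ) U₀ c.k (ctr c.a c.M))) ∧ Restr129 L 1 ((cubeLamS L c.a c.M c.ρ c.k) 1) (1 : Site d → Fin d → 𝔸ˣ) ((1 : Site d →
          𝔸ˣ) * v))) →
      ((∀ m, 1 ≤ m → m < c.k → ∀ (u₁ : Site d → 𝔸ˣ) (U₁ : Site d → Fin d → 𝔸ˣ) (A : Site d → Fin d → 𝔸),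
        (∀ x, u₁ x ∈ unitaryUnits 𝔸) → (∀ x, x ∉ (cubeFam false L c.a c.M c.ρ c.k) 0 → u₁ x = 1) → mgauge (1 : Site d → Fin d →
          𝔸ˣ) u₁ U₁ = (cutFixed L (tLo c.a c.ρ) (tHi c.a c.M c.ρ) U₀ c.k (ctr c.a c.M)) → Restr129 L m ((cubeLamS L c.a c.M c.ρ c.k) m) (1 : Site d → Fin d → 𝔸ˣ) u₁ →
        IsLandau138W L m η ((cubeFam false L c.a c.M c.ρ c.k) 0) ((cubeLamS L c.a c.M c.ρ c.k) m) (1 : Site d → Fin d → 𝔸ˣ) U₁ →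
        (∀ j, j ≤ m → ∀ b ∈ {b : Site d × Fin d | SideTouches ((cubeFam false L c.a c.M c.ρ c.k) j) b.1 b.2},
        U₁ b.1 b.2 = cfgExp η A b.1 b.2 ∧ IsSelfAdjoint (A b.1 b.2) ∧
          ‖A b.1 b.2‖ ≤ (5 * (d : ℝ) * L * B₀ * (((L : ℝ) ^ 3 * α₀) + (6 * d * (L : ℝ) ^ 2 * c.M * α₀))) * ((L : ℝ) ^ j * η)⁻¹) →
        ∃ (v : Site d → 𝔸ˣ) (lam : Site d → 𝔸), (∀ x, v x ∈ unitaryUnits 𝔸) ∧ (∀ x, x ∉ (cubeFam false L c.a c.M c.ρ c.k) 0 → v x = 1) ∧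
        (∀ j, j ≤ m + 1 →
          ∀ b ∈ {b : Site d × Fin d | SideTouches ((cubeFam false L c.a c.M c.ρ c.k) j) b.1 b.2}, (v b.1 : 𝔸) = ((gaugeExp lam b.1 : 𝔸ˣ) : 𝔸) ∧
        (v (b.1 + e b.2) : 𝔸) = ((gaugeExp lam (b.1 + e b.2) : 𝔸ˣ) : 𝔸)) ∧
        (∀ j, j ≤ m + 1 → ∀ b ∈ {b : Site d × Fin d | SideTouches ((cubeFam false L c.a c.M c.ρ c.k) j) b.1 b.2},
        ‖lam b.1‖ ≤ (8 * B₀' * (5 * (d : ℝ) * L * B₀) * (((L : ℝ) ^ 3 * α₀) + (6 * d * (L : ℝ) ^ 2 * c.M * α₀))) ∧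
          ((L : ℝ) ^ j * η) * ‖covDerivFwd η (1 : Site d → Fin d →
          𝔸ˣ) b.2 lam b.1‖ ≤ (8 * B₀' * (5 * (d : ℝ) * L * B₀) * (((L : ℝ) ^ 3 * α₀) + (6 * d * (L : ℝ) ^ 2 * c.M * α₀)))) ∧
        IsLandau138W L (m + 1) η ((cubeFam false L c.a c.M c.ρ c.k) 0) ((cubeLamS L c.a c.M c.ρ c.k) (m + 1)) (1 : Site d → Fin d → 𝔸ˣ) (mgauge (1 : Site d → Fin d →
          𝔸ˣ) v⁻¹ U₁) ∧ Restr129 L (m + 1) ((cubeLamS L c.a c.M c.ρ c.k) (m + 1)) (1 : Site d → Fin d → 𝔸ˣ) (u₁ * v))) →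
      ((∀ m, 1 ≤ m → m ≤ c.k → ∀ (u : Site d → 𝔸ˣ) (W : Site d → Fin d → 𝔸ˣ) (A' : Site d → Fin d → 𝔸),
        (∀ x, u x ∈ unitaryUnits 𝔸) → mgauge (1 : Site d → Fin d → 𝔸ˣ) u W = (cutFixed L (tLo c.a c.ρ) (tHi c.a c.M c.ρ) U₀ c.k (ctr c.a c.M)) →
          Restr129 L m ((cubeLamS L c.a c.M c.ρ c.k) m) (1 : Site d → Fin d → 𝔸ˣ) u →
          IsLandau138W L m η ((cubeFam false L c.a c.M c.ρ c.k) 0) ((cubeLamS L c.a c.M c.ρ c.k) m) (1 : Site d → Fin d → 𝔸ˣ) W →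
        (∀ y τ, IsSelfAdjoint (A' y τ)) →
        (∀ j, j ≤ m → ∀ y τ, SideTouches ((cubeFam false L c.a c.M c.ρ c.k) j) y τ →
        W y τ = cfgExp η A' y τ ∧
          ‖A' y τ‖ ≤ (2 * (L * (5 * (d : ℝ) * L * B₀ * (((L : ℝ) ^ 3 * α₀) + (6 * d * (L : ℝ) ^ 2 * c.M * α₀)))) + 8 * (8 * B₀' * (5 * (d : ℝ) * L * B₀) * (((L : ℝ) ^ 3 * α₀) + (6 * d * (L : ℝ) ^ 2 * c.M * α₀)))) * ((L : ℝ) ^ j * η)⁻¹) →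
        (∀ y τ, (∀ j, j ≤ m → ¬ SideTouches ((cubeFam false L c.a c.M c.ρ c.k) j) y τ) → A' y τ = 0) →
        msup L m η (-(1 : ℝ)) (fun j (b : Site d × Fin d) => SideTouches ((cubeFam false L c.a c.M c.ρ c.k) j) b.1 b.2) (fun b => A' b.1 b.2)
        ≤ B₀ * (bondNorm L m η (-(3 : ℝ)) (cubeFam false L c.a c.M c.ρ c.k) (fun x μ => Jcur η (1 : Site d → Fin d → 𝔸ˣ) A' μ x)
        + wsup 1 (fun p : {p : ℕ × (Site d × Fin d) // p.1 ≤ m ∧ p.2 ∈ (cubeLamB L c.a c.M c.ρ c.k) m p.1} =>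
        linCovIter L (1 : Site d → Fin d → 𝔸ˣ) (iEta η A') p.1.1 p.1.2.1 p.1.2.2)) ∧
        msup L m η (-(2 : ℝ)) (fun j (t : Fin d × Fin d × Site d) => SideTouches ((cubeFam false L c.a c.M c.ρ c.k) j) t.2.2 t.2.1)
        (fun t => covDerivFwd η (1 : Site d → Fin d → 𝔸ˣ) t.1 (fun z => A' z t.2.1) t.2.2)
        ≤ B₀ * (bondNorm L m η (-(3 : ℝ)) (cubeFam false L c.a c.M c.ρ c.k) (fun x μ => Jcur η (1 : Site d → Fin d → 𝔸ˣ) A' μ x)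
        + wsup 1 (fun p : {p : ℕ × (Site d × Fin d) // p.1 ≤ m ∧ p.2 ∈ (cubeLamB L c.a c.M c.ρ c.k) m p.1} =>
        linCovIter L (1 : Site d → Fin d → 𝔸ˣ) (iEta η A') p.1.1 p.1.2.1 p.1.2.2)))) →
      GaugedBoundB8 L η U₀ c (7 * d * (L : ℝ) ^ 2 * (5 * (d : ℝ) * L * B₀) * c.M * α₀) := by
  have hL1 : 1 ≤ L := le_trans (by norm_num) hL
  have hd1 : 1 ≤ d := le_trans (by norm_num) hd2
  have hLpos : (0 : ℝ) < L := by exact_mod_cast hL1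
  have hdpos : (0 : ℝ) < d := by exact_mod_cast hd1
  have hC₂0 : 0 ≤ C₂ := le_trans (by positivity) hC₂
  obtain ⟨c₄, hc₄, H4⟩ := prop6_exists_cubeMember_at₃ (𝔸 := 𝔸) hd2 hL hB₀ hB₀' hB
  obtain ⟨c₃, hc₃, H3⟩ := norms136_cubeMember_printed_flat (𝔸 := 𝔸) hd2 hL hB₀ hB₀β hC₂ hcB9 β len
  obtain ⟨cW, hcW, W⟩ := windows136_of_small hd2 hL hB₀ hC₂0 one_pos
  set B : ℝ := 5 * (d : ℝ) * L * B₀ with hB_def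
  have hB0 : 0 < B := by positivity
  set C : ℝ := 131072 * ((d : ℝ) + 1) ^ 2 with hC_def
  have hC0 : 0 < C := by positivity
  refine ⟨min c₄ (min c₃ (min cW (1 / (16 * C * B)))), lt_min hc₄ (lt_min hc₃ (lt_min hcW (by positivity))), ?_⟩
  intro η hη K Ω c SB9 U₀ hU₀ α₀ hα hAK hs P5b P5s H59
  have hk : 1 ≤ c.k := c.one_le_k
  have hρ : 1 ≤ c.ρ := hL1.trans c.L_le_ρ
  have hM1 : 1 ≤ c.M := hρ.trans c.ρ_le_M
  have hM : 11 * (d : ℝ) < c.M := by exact_mod_cast c.big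
  have hLdM : (L : ℝ) ≤ d * c.M := by exact_mod_cast c.L_le_dM
  have hA : InAk L c.k η α₀ Ω U₀ := c.inAk hAK
  have hs₄ : 7 * d * (L : ℝ) ^ 2 * c.M * α₀ ≤ c₄ := hs.trans (min_le_left _ _)
  have hs₃ : 7 * d * (L : ℝ) ^ 2 * c.M * α₀ ≤ c₃ := hs.trans ((min_le_right _ _).trans (min_le_left _ _))
  have hsW : 7 * d * (L : ℝ) ^ 2 * c.M * α₀ ≤ cW := hs.trans ((min_le_right _ _).trans ((min_le_right _ _).trans (min_le_left _ _)))
  have hsC : 7 * d * (L : ℝ) ^ 2 * c.M * α₀ ≤ 1 / (16 * C * B) :=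
    hs.trans ((min_le_right _ _).trans ((min_le_right _ _).trans (min_le_right _ _)))
  obtain ⟨⟨hα3, hα2, hsmall⟩, -, -, ⟨-, -, -, -, hc3α, -⟩, h12⟩ := W c.M c.ρ hM1 c.ρ_le_M hM hLdM α₀ hα hsW
  obtain ⟨u, hu, huS, h129, hLan, h162, hw, h135⟩ := H4 η hη c.k hk c.a c.M c.ρ c.L_le_ρ c.ρ_le_M hM U₀ hU₀ α₀ hα hα3 hα2 Ω hA
    c.tcube_sub hsmall (smallness_134 hLpos hα hLdM hs₄) P5b P5s H59
  obtain ⟨-, h136₂, -, h136₃, h136₄⟩ := H3 η hη c.k hk c.a c.M c.ρ c.L_le_ρ c.ρ_le_M hM hLdM SB9 U₀ hU₀ α₀ hα Ω hA c.tcube_sub hs₃ u hu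
    h129 hLan h162
  have h16C : 16 * (131072 * ((d : ℝ) + 1) ^ 2) * (B * ((L : ℝ) ^ 3 * α₀ + 6 * d * (L : ℝ) ^ 2 * c.M * α₀)) ≤ 1 := by
    have e1 : B * ((L : ℝ) ^ 3 * α₀ + 6 * d * (L : ℝ) ^ 2 * c.M * α₀) ≤ 7 * d * (L : ℝ) ^ 2 * B * c.M * α₀ :=
      const_136 hLpos hα hB0.le hLdM
    have e3 : B * (7 * d * (L : ℝ) ^ 2 * c.M * α₀) ≤ B * (1 / (16 * C * B)) := mul_le_mul_of_nonneg_left hsC hB0.le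
    have e4 : B * (1 / (16 * C * B)) = 1 / (16 * C) := by field_simp
    have e2 : 7 * d * (L : ℝ) ^ 2 * B * c.M * α₀ = B * (7 * d * (L : ℝ) ^ 2 * c.M * α₀) := by ring
    have e5 : B * ((L : ℝ) ^ 3 * α₀ + 6 * d * (L : ℝ) ^ 2 * c.M * α₀) ≤ 1 / (16 * C) := by linarith [e1, e3]
    calc 16 * (131072 * ((d : ℝ) + 1) ^ 2) * (B * ((L : ℝ) ^ 3 * α₀ + 6 * d * (L : ℝ) ^ 2 * c.M * α₀))
        ≤ 16 * C * (1 / (16 * C)) := mul_le_mul_of_nonneg_left e5 (by positivity)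
      _ = 1 := by field_simp
  exact gaugedBoundB8_of_clauses hd2 hL hB₀ hη c U₀ hU₀ hα hA hα3 hα2 hsmall h12 h16C hc3α u hu huS h129 hLan h162 hw h135 h136₂ h136₃ h136₄

/-! ## §2 `B8.Prop6Printed` on `zdCub ∘ f` from the flat inputs -/

/-- **`B8.Prop6Printed d L (5dLB₀) c₁ (zdCub ∘ f)` FROM THE FLAT INPUTS AT EVERY CUBE** — the knit's `p6` letter (consumed by
`B8LeafKnitZd3Cub` ∕ the pin faces at `lam.withCub(On)`) with hypotheses, per cube `c` of every `f j`: the (1.59) body for `G(1)` on the cube family,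
and for every admissible `(U₀, α₀)` Theorem 4's three existence inputs at the flat pair `(1, U₀″)` — no ∀-background socket, no uniqueness input.
[cite: Balaban1985RegularSpaces, Prop. 6 p.99, Thm 4 p.88 (existence), Prop. 3 p.87, Prop. 5 p.94, (1.59) p.86] -/
theorem prop6Printed_zdCub_flat₃ (hd2 : 2 ≤ d) {L : ℕ} (hL : 2 ≤ L) {B₀ B₀' B₀β C₂ cB9 : ℝ} (hB₀ : 0 < B₀)
    (hB₀' : 0 < B₀') (hB : 2 ≤ 5 * (d : ℝ) * L * B₀) (hB₀β : 0 ≤ B₀β) (hC₂ : 2097152 * ((d : ℝ) + 1) ^ 2 ≤ C₂) (hcB9 : 0 < cB9)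
    (β : ℝ) (len : Site d → ℝ) :
    ∃ c₁ : ℝ, 0 < c₁ ∧ ∀ {ι : Type} (f : ι → ZdIdx d L),
      (∀ (i : ι) (c : CubeB8 d L (f i).k (f i).Ω),
      (∀ α₀' α₂ : ℝ, 0 < α₀' → α₀' ≤ cB9 → 0 < α₂ → α₂ ≤ cB9 →
        ∀ (W : Site d → Fin d → 𝔸ˣ), (∀ x κ, W x κ ∈ unitaryUnits 𝔸) →
        InAk L c.k (f i).η α₀' (cubeFam false L c.a c.M c.ρ c.k) (1 : Site d → Fin d → 𝔸ˣ) → InAk L c.k (f i).η α₀' (cubeFam false L c.a c.M c.ρ c.k) (mulCfg W (1 : Site d → Fin d → 𝔸ˣ)) →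
        IsLandau138W L c.k (f i).η (cubeFam false L c.a c.M c.ρ c.k 0) (cubeLamS L c.a c.M c.ρ c.k c.k) (1 : Site d → Fin d → 𝔸ˣ) W →
        ∀ A' : Site d → Fin d → 𝔸, (∀ y τ, IsSelfAdjoint (A' y τ)) →
        (∀ j, j ≤ c.k → ∀ (y : Site d) (τ : Fin d), SideTouches (cubeFam false L c.a c.M c.ρ c.k j) y τ →
          W y τ = cfgExp (f i).η A' y τ ∧ ‖A' y τ‖ ≤ α₂ * ((L : ℝ) ^ j * (f i).η)⁻¹) →
        (∀ (y : Site d) (τ : Fin d), (∀ j, j ≤ c.k → ¬ SideTouches (cubeFam false L c.a c.M c.ρ c.k j) y τ) → A' y τ = 0) →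
        msup L c.k (f i).η (-(1 : ℝ)) (fun j (b : Site d × Fin d) => SideTouches (cubeFam false L c.a c.M c.ρ c.k j) b.1 b.2) (fun b => A' b.1 b.2)
            ≤ B₀ * (bondNorm L c.k (f i).η (-(3 : ℝ)) (cubeFam false L c.a c.M c.ρ c.k) (fun x μ => Jcur (f i).η (1 : Site d → Fin d → 𝔸ˣ) A' μ x)
              + wsup 1 (fun p : {p : ℕ × (Site d × Fin d) // p.1 ≤ c.k ∧ p.2 ∈ cubeLamB L c.a c.M c.ρ c.k c.k p.1} =>
                  linCovIter L (1 : Site d → Fin d → 𝔸ˣ) (iEta (f i).η A') p.1.1 p.1.2.1 p.1.2.2)) ∧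
          msup L c.k (f i).η (-(2 : ℝ)) (fun j (t : Fin d × Fin d × Site d) => SideTouches (cubeFam false L c.a c.M c.ρ c.k j) t.2.2 t.2.1)
              (fun t => covDerivFwd (f i).η (1 : Site d → Fin d → 𝔸ˣ) t.1 (fun z => A' z t.2.1) t.2.2)
            ≤ B₀ * (bondNorm L c.k (f i).η (-(3 : ℝ)) (cubeFam false L c.a c.M c.ρ c.k) (fun x μ => Jcur (f i).η (1 : Site d → Fin d → 𝔸ˣ) A' μ x)
              + wsup 1 (fun p : {p : ℕ × (Site d × Fin d) // p.1 ≤ c.k ∧ p.2 ∈ cubeLamB L c.a c.M c.ρ c.k c.k p.1} =>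
                  linCovIter L (1 : Site d → Fin d → 𝔸ˣ) (iEta (f i).η A') p.1.1 p.1.2.1 p.1.2.2)) ∧
          bondNorm L c.k (f i).η (-(3 : ℝ)) (cubeFam false L c.a c.M c.ρ c.k) (fun x μ => pdiv (f i).η (1 : Site d → Fin d → 𝔸ˣ) (plaqCovDeriv (f i).η (1 : Site d → Fin d → 𝔸ˣ) A') μ x)
            ≤ B₀ * (bondNorm L c.k (f i).η (-(3 : ℝ)) (cubeFam false L c.a c.M c.ρ c.k) (fun x μ => Jcur (f i).η (1 : Site d → Fin d → 𝔸ˣ) A' μ x)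
              + wsup 1 (fun p : {p : ℕ × (Site d × Fin d) // p.1 ≤ c.k ∧ p.2 ∈ cubeLamB L c.a c.M c.ρ c.k c.k p.1} =>
                  linCovIter L (1 : Site d → Fin d → 𝔸ˣ) (iEta (f i).η A') p.1.1 p.1.2.1 p.1.2.2)) ∧
          bondNorm L c.k (f i).η (-(3 : ℝ)) (cubeFam false L c.a c.M c.ρ c.k) (fun x μ => covLap (f i).η (1 : Site d → Fin d → 𝔸ˣ) (fun z => A' z μ) x)
            ≤ B₀ * (bondNorm L c.k (f i).η (-(3 : ℝ)) (cubeFam false L c.a c.M c.ρ c.k) (fun x μ => Jcur (f i).η (1 : Site d → Fin d → 𝔸ˣ) A' μ x)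
              + wsup 1 (fun p : {p : ℕ × (Site d × Fin d) // p.1 ≤ c.k ∧ p.2 ∈ cubeLamB L c.a c.M c.ρ c.k c.k p.1} =>
                  linCovIter L (1 : Site d → Fin d → 𝔸ˣ) (iEta (f i).η A') p.1.1 p.1.2.1 p.1.2.2)) ∧
          msup L c.k (f i).η (-(2 + β)) (fun j (q : Fin d × Fin d × (Site d × Site d)) => q.2.2 ∈ AdmPair (f i).η len ∧ q.2.2.1 ∈ cubeFam false L c.a c.M c.ρ c.k j)
              (fun q => hquot (f i).η β len (1 : Site d → Fin d → 𝔸ˣ) (covDerivFwd (f i).η (1 : Site d → Fin d → 𝔸ˣ) q.1 (fun z => A' z q.2.1)) q.2.2)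
            ≤ B₀β * (bondNorm L c.k (f i).η (-(3 : ℝ)) (cubeFam false L c.a c.M c.ρ c.k) (fun x μ => Jcur (f i).η (1 : Site d → Fin d → 𝔸ˣ) A' μ x)
              + wsup 1 (fun p : {p : ℕ × (Site d × Fin d) // p.1 ≤ c.k ∧ p.2 ∈ cubeLamB L c.a c.M c.ρ c.k c.k p.1} =>
                  linCovIter L (1 : Site d → Fin d → 𝔸ˣ) (iEta (f i).η A') p.1.1 p.1.2.1 p.1.2.2))) ∧
      ∀ (U₀ : Site d → Fin d → 𝔸ˣ), (∀ x κ, U₀ x κ ∈ unitaryUnits 𝔸) → ∀ (α₀ : ℝ), 0 < α₀ → InAk L (f i).k (f i).η α₀ (f i).Ω U₀ →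
      ((∃ (v : Site d → 𝔸ˣ) (lam : Site d → 𝔸), (∀ x, v x ∈ unitaryUnits 𝔸) ∧ (∀ x, x ∉ (cubeFam false L c.a c.M c.ρ c.k) 0 → v x = 1) ∧
        (∀ j, j ≤ 1 → ∀ b ∈ {b : Site d × Fin d | SideTouches ((cubeFam false L c.a c.M c.ρ c.k) j) b.1 b.2}, (v b.1 : 𝔸) = ((gaugeExp lam b.1 : 𝔸ˣ) : 𝔸) ∧
        (v (b.1 + e b.2) : 𝔸) = ((gaugeExp lam (b.1 + e b.2) : 𝔸ˣ) : 𝔸)) ∧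
        (∀ j, j ≤ 1 → ∀ b ∈ {b : Site d × Fin d | SideTouches ((cubeFam false L c.a c.M c.ρ c.k) j) b.1 b.2},
        ‖lam b.1‖ ≤ (8 * B₀' * (5 * (d : ℝ) * L * B₀) * (((L : ℝ) ^ 3 * α₀) + (6 * d * (L : ℝ) ^ 2 * c.M * α₀))) ∧
          ((L : ℝ) ^ j * (f i).η) * ‖covDerivFwd (f i).η (1 : Site d → Fin d →
          𝔸ˣ) b.2 lam b.1‖ ≤ (8 * B₀' * (5 * (d : ℝ) * L * B₀) * (((L : ℝ) ^ 3 * α₀) + (6 * d * (L : ℝ) ^ 2 * c.M * α₀)))) ∧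
        IsLandau138W L 1 (f i).η ((cubeFam false L c.a c.M c.ρ c.k) 0) ((cubeLamS L c.a c.M c.ρ c.k) 1) (1 : Site d → Fin d → 𝔸ˣ) (mgauge (1 : Site d → Fin d →
          𝔸ˣ) v⁻¹ (cutFixed L (tLo c.a c.ρ) (tHi c.a c.M c.ρ) U₀ c.k (ctr c.a c.M))) ∧ Restr129 L 1 ((cubeLamS L c.a c.M c.ρ c.k) 1) (1 : Site d → Fin d → 𝔸ˣ) ((1 : Site d →
          𝔸ˣ) * v))) ∧
      ((∀ m, 1 ≤ m → m < c.k → ∀ (u₁ : Site d → 𝔸ˣ) (U₁ : Site d → Fin d → 𝔸ˣ) (A : Site d → Fin d → 𝔸),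
        (∀ x, u₁ x ∈ unitaryUnits 𝔸) → (∀ x, x ∉ (cubeFam false L c.a c.M c.ρ c.k) 0 → u₁ x = 1) → mgauge (1 : Site d → Fin d →
          𝔸ˣ) u₁ U₁ = (cutFixed L (tLo c.a c.ρ) (tHi c.a c.M c.ρ) U₀ c.k (ctr c.a c.M)) → Restr129 L m ((cubeLamS L c.a c.M c.ρ c.k) m) (1 : Site d → Fin d → 𝔸ˣ) u₁ →
        IsLandau138W L m (f i).η ((cubeFam false L c.a c.M c.ρ c.k) 0) ((cubeLamS L c.a c.M c.ρ c.k) m) (1 : Site d → Fin d → 𝔸ˣ) U₁ →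
        (∀ j, j ≤ m → ∀ b ∈ {b : Site d × Fin d | SideTouches ((cubeFam false L c.a c.M c.ρ c.k) j) b.1 b.2},
        U₁ b.1 b.2 = cfgExp (f i).η A b.1 b.2 ∧ IsSelfAdjoint (A b.1 b.2) ∧
          ‖A b.1 b.2‖ ≤ (5 * (d : ℝ) * L * B₀ * (((L : ℝ) ^ 3 * α₀) + (6 * d * (L : ℝ) ^ 2 * c.M * α₀))) * ((L : ℝ) ^ j * (f i).η)⁻¹) →
        ∃ (v : Site d → 𝔸ˣ) (lam : Site d → 𝔸), (∀ x, v x ∈ unitaryUnits 𝔸) ∧ (∀ x, x ∉ (cubeFam false L c.a c.M c.ρ c.k) 0 → v x = 1) ∧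
        (∀ j, j ≤ m + 1 →
          ∀ b ∈ {b : Site d × Fin d | SideTouches ((cubeFam false L c.a c.M c.ρ c.k) j) b.1 b.2}, (v b.1 : 𝔸) = ((gaugeExp lam b.1 : 𝔸ˣ) : 𝔸) ∧
        (v (b.1 + e b.2) : 𝔸) = ((gaugeExp lam (b.1 + e b.2) : 𝔸ˣ) : 𝔸)) ∧
        (∀ j, j ≤ m + 1 → ∀ b ∈ {b : Site d × Fin d | SideTouches ((cubeFam false L c.a c.M c.ρ c.k) j) b.1 b.2},
        ‖lam b.1‖ ≤ (8 * B₀' * (5 * (d : ℝ) * L * B₀) * (((L : ℝ) ^ 3 * α₀) + (6 * d * (L : ℝ) ^ 2 * c.M * α₀))) ∧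
          ((L : ℝ) ^ j * (f i).η) * ‖covDerivFwd (f i).η (1 : Site d → Fin d →
          𝔸ˣ) b.2 lam b.1‖ ≤ (8 * B₀' * (5 * (d : ℝ) * L * B₀) * (((L : ℝ) ^ 3 * α₀) + (6 * d * (L : ℝ) ^ 2 * c.M * α₀)))) ∧
        IsLandau138W L (m + 1) (f i).η ((cubeFam false L c.a c.M c.ρ c.k) 0) ((cubeLamS L c.a c.M c.ρ c.k) (m + 1)) (1 : Site d → Fin d → 𝔸ˣ) (mgauge (1 : Site d → Fin d →
          𝔸ˣ) v⁻¹ U₁) ∧ Restr129 L (m + 1) ((cubeLamS L c.a c.M c.ρ c.k) (m + 1)) (1 : Site d → Fin d → 𝔸ˣ) (u₁ * v))) ∧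
      ((∀ m, 1 ≤ m → m ≤ c.k → ∀ (u : Site d → 𝔸ˣ) (W : Site d → Fin d → 𝔸ˣ) (A' : Site d → Fin d → 𝔸),
        (∀ x, u x ∈ unitaryUnits 𝔸) → mgauge (1 : Site d → Fin d → 𝔸ˣ) u W = (cutFixed L (tLo c.a c.ρ) (tHi c.a c.M c.ρ) U₀ c.k (ctr c.a c.M)) →
          Restr129 L m ((cubeLamS L c.a c.M c.ρ c.k) m) (1 : Site d → Fin d → 𝔸ˣ) u →
          IsLandau138W L m (f i).η ((cubeFam false L c.a c.M c.ρ c.k) 0) ((cubeLamS L c.a c.M c.ρ c.k) m) (1 : Site d → Fin d → 𝔸ˣ) W →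
        (∀ y τ, IsSelfAdjoint (A' y τ)) →
        (∀ j, j ≤ m → ∀ y τ, SideTouches ((cubeFam false L c.a c.M c.ρ c.k) j) y τ →
        W y τ = cfgExp (f i).η A' y τ ∧
          ‖A' y τ‖ ≤ (2 * (L * (5 * (d : ℝ) * L * B₀ * (((L : ℝ) ^ 3 * α₀) + (6 * d * (L : ℝ) ^ 2 * c.M * α₀)))) + 8 * (8 * B₀' * (5 * (d : ℝ) * L * B₀) * (((L : ℝ) ^ 3 * α₀) + (6 * d * (L : ℝ) ^ 2 * c.M * α₀)))) * ((L : ℝ) ^ j * (f i).η)⁻¹) →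
        (∀ y τ, (∀ j, j ≤ m → ¬ SideTouches ((cubeFam false L c.a c.M c.ρ c.k) j) y τ) → A' y τ = 0) →
        msup L m (f i).η (-(1 : ℝ)) (fun j (b : Site d × Fin d) => SideTouches ((cubeFam false L c.a c.M c.ρ c.k) j) b.1 b.2) (fun b => A' b.1 b.2)
        ≤ B₀ * (bondNorm L m (f i).η (-(3 : ℝ)) (cubeFam false L c.a c.M c.ρ c.k) (fun x μ => Jcur (f i).η (1 : Site d → Fin d → 𝔸ˣ) A' μ x)
        + wsup 1 (fun p : {p : ℕ × (Site d × Fin d) // p.1 ≤ m ∧ p.2 ∈ (cubeLamB L c.a c.M c.ρ c.k) m p.1} =>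
        linCovIter L (1 : Site d → Fin d → 𝔸ˣ) (iEta (f i).η A') p.1.1 p.1.2.1 p.1.2.2)) ∧
        msup L m (f i).η (-(2 : ℝ)) (fun j (t : Fin d × Fin d × Site d) => SideTouches ((cubeFam false L c.a c.M c.ρ c.k) j) t.2.2 t.2.1)
        (fun t => covDerivFwd (f i).η (1 : Site d → Fin d → 𝔸ˣ) t.1 (fun z => A' z t.2.1) t.2.2)
        ≤ B₀ * (bondNorm L m (f i).η (-(3 : ℝ)) (cubeFam false L c.a c.M c.ρ c.k) (fun x μ => Jcur (f i).η (1 : Site d → Fin d → 𝔸ˣ) A' μ x)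
        + wsup 1 (fun p : {p : ℕ × (Site d × Fin d) // p.1 ≤ m ∧ p.2 ∈ (cubeLamB L c.a c.M c.ρ c.k) m p.1} =>
        linCovIter L (1 : Site d → Fin d → 𝔸ˣ) (iEta (f i).η A') p.1.1 p.1.2.1 p.1.2.2))))) →
      B8.Prop6Printed d (L : ℝ) (5 * (d : ℝ) * L * B₀) c₁ (fun j => zdCub 𝔸 L (f j)) := by
  obtain ⟨c₁, hc₁, G⟩ := gaugedBoundB8_cubeMember_flat₃ (𝔸 := 𝔸) hd2 hL hB₀ hB₀' hB hB₀β hC₂ hcB9 β len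
  refine ⟨c₁, hc₁, fun f S => ?_⟩
  rw [prop6Printed_zdCub_iff]
  intro j α₀ hα U₀ hInA c hs
  obtain ⟨S₉, ST⟩ := S j c
  obtain ⟨P5b, P5s, H59⟩ := ST U₀.1 U₀.2 α₀ hα hInA
  exact G (f j).η (f j).hη c S₉ U₀.1 U₀.2 α₀ hα hInA hs P5b P5s H59

/-- **`B8.Prop6Printed` ON NODE 00's MEMBER OF RECORD `Node00.cubB8OfRecord θ` FROM THE FLAT INPUTS** — `prop6Printed_zdCub_flat₃` at `f := Subtype.val`
(the `p6` letter of a pin face at the located layer `lam.withCub`; for a cut layer `lam.withCubOn P` take `prop6Printed_zdCub_flat₃` at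
`f := fun i : {i ∕∕ P i} => i.1.1`), `θ.D ≥ 2`, `B₁ := 5·θ.D·θ.L·B₀`. [cite: Balaban1985RegularSpaces, Prop. 6 p.99, Thm 4 p.88 (existence), Prop. 3 p.87, Prop. 5 p.94, (1.59) p.86] -/
theorem prop6Printed_cubB8OfRecord_flat₃ (θ : Node00.Stage3Params) (hD : 2 ≤ θ.D) {B₀ B₀' B₀β C₂ cB9 : ℝ} (hB₀ : 0 < B₀)
    (hB₀' : 0 < B₀') (hB : 2 ≤ 5 * (θ.D : ℝ) * θ.L * B₀) (hB₀β : 0 ≤ B₀β) (hC₂ : 2097152 * ((θ.D : ℝ) + 1) ^ 2 ≤ C₂) (hcB9 : 0 < cB9)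
    (β : ℝ) (len : Site θ.D → ℝ) :
    ∃ c₁ : ℝ, 0 < c₁ ∧
      ((∀ (i : Node00.IdxB8 θ) (c : CubeB8 θ.D θ.L i.1.k i.1.Ω),
      (∀ α₀' α₂ : ℝ, 0 < α₀' → α₀' ≤ cB9 → 0 < α₂ → α₂ ≤ cB9 →
        ∀ (W : Site θ.D → Fin θ.D → θ.𝔸ˣ), (∀ x κ, W x κ ∈ unitaryUnits θ.𝔸) →
        InAk θ.L c.k i.1.η α₀' (cubeFam false θ.L c.a c.M c.ρ c.k) (1 : Site θ.D → Fin θ.D → θ.𝔸ˣ) → InAk θ.L c.k i.1.η α₀' (cubeFam false θ.L c.a c.M c.ρ c.k) (mulCfg W (1 : Site θ.D → Fin θ.D → θ.𝔸ˣ)) →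
        IsLandau138W θ.L c.k i.1.η (cubeFam false θ.L c.a c.M c.ρ c.k 0) (cubeLamS θ.L c.a c.M c.ρ c.k c.k) (1 : Site θ.D → Fin θ.D → θ.𝔸ˣ) W →
        ∀ A' : Site θ.D → Fin θ.D → θ.𝔸, (∀ y τ, IsSelfAdjoint (A' y τ)) →
        (∀ j, j ≤ c.k → ∀ (y : Site θ.D) (τ : Fin θ.D), SideTouches (cubeFam false θ.L c.a c.M c.ρ c.k j) y τ →
          W y τ = cfgExp i.1.η A' y τ ∧ ‖A' y τ‖ ≤ α₂ * ((θ.L : ℝ) ^ j * i.1.η)⁻¹) →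
        (∀ (y : Site θ.D) (τ : Fin θ.D), (∀ j, j ≤ c.k → ¬ SideTouches (cubeFam false θ.L c.a c.M c.ρ c.k j) y τ) → A' y τ = 0) →
        msup θ.L c.k i.1.η (-(1 : ℝ)) (fun j (b : Site θ.D × Fin θ.D) => SideTouches (cubeFam false θ.L c.a c.M c.ρ c.k j) b.1 b.2) (fun b => A' b.1 b.2)
            ≤ B₀ * (bondNorm θ.L c.k i.1.η (-(3 : ℝ)) (cubeFam false θ.L c.a c.M c.ρ c.k) (fun x μ => Jcur i.1.η (1 : Site θ.D → Fin θ.D → θ.𝔸ˣ) A' μ x)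
              + wsup 1 (fun p : {p : ℕ × (Site θ.D × Fin θ.D) // p.1 ≤ c.k ∧ p.2 ∈ cubeLamB θ.L c.a c.M c.ρ c.k c.k p.1} =>
                  linCovIter θ.L (1 : Site θ.D → Fin θ.D → θ.𝔸ˣ) (iEta i.1.η A') p.1.1 p.1.2.1 p.1.2.2)) ∧
          msup θ.L c.k i.1.η (-(2 : ℝ)) (fun j (t : Fin θ.D × Fin θ.D × Site θ.D) => SideTouches (cubeFam false θ.L c.a c.M c.ρ c.k j) t.2.2 t.2.1)
              (fun t => covDerivFwd i.1.η (1 : Site θ.D → Fin θ.D → θ.𝔸ˣ) t.1 (fun z => A' z t.2.1) t.2.2)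
            ≤ B₀ * (bondNorm θ.L c.k i.1.η (-(3 : ℝ)) (cubeFam false θ.L c.a c.M c.ρ c.k) (fun x μ => Jcur i.1.η (1 : Site θ.D → Fin θ.D → θ.𝔸ˣ) A' μ x)
              + wsup 1 (fun p : {p : ℕ × (Site θ.D × Fin θ.D) // p.1 ≤ c.k ∧ p.2 ∈ cubeLamB θ.L c.a c.M c.ρ c.k c.k p.1} =>
                  linCovIter θ.L (1 : Site θ.D → Fin θ.D → θ.𝔸ˣ) (iEta i.1.η A') p.1.1 p.1.2.1 p.1.2.2)) ∧
          bondNorm θ.L c.k i.1.η (-(3 : ℝ)) (cubeFam false θ.L c.a c.M c.ρ c.k) (fun x μ => pdiv i.1.η (1 : Site θ.D → Fin θ.D → θ.𝔸ˣ) (plaqCovDeriv i.1.η (1 : Site θ.D → Fin θ.D → θ.𝔸ˣ) A') μ x)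
            ≤ B₀ * (bondNorm θ.L c.k i.1.η (-(3 : ℝ)) (cubeFam false θ.L c.a c.M c.ρ c.k) (fun x μ => Jcur i.1.η (1 : Site θ.D → Fin θ.D → θ.𝔸ˣ) A' μ x)
              + wsup 1 (fun p : {p : ℕ × (Site θ.D × Fin θ.D) // p.1 ≤ c.k ∧ p.2 ∈ cubeLamB θ.L c.a c.M c.ρ c.k c.k p.1} =>
                  linCovIter θ.L (1 : Site θ.D → Fin θ.D → θ.𝔸ˣ) (iEta i.1.η A') p.1.1 p.1.2.1 p.1.2.2)) ∧
          bondNorm θ.L c.k i.1.η (-(3 : ℝ)) (cubeFam false θ.L c.a c.M c.ρ c.k) (fun x μ => covLap i.1.η (1 : Site θ.D → Fin θ.D → θ.𝔸ˣ) (fun z => A' z μ) x)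
            ≤ B₀ * (bondNorm θ.L c.k i.1.η (-(3 : ℝ)) (cubeFam false θ.L c.a c.M c.ρ c.k) (fun x μ => Jcur i.1.η (1 : Site θ.D → Fin θ.D → θ.𝔸ˣ) A' μ x)
              + wsup 1 (fun p : {p : ℕ × (Site θ.D × Fin θ.D) // p.1 ≤ c.k ∧ p.2 ∈ cubeLamB θ.L c.a c.M c.ρ c.k c.k p.1} =>
                  linCovIter θ.L (1 : Site θ.D → Fin θ.D → θ.𝔸ˣ) (iEta i.1.η A') p.1.1 p.1.2.1 p.1.2.2)) ∧
          msup θ.L c.k i.1.η (-(2 + β)) (fun j (q : Fin θ.D × Fin θ.D × (Site θ.D × Site θ.D)) => q.2.2 ∈ AdmPair i.1.η len ∧ q.2.2.1 ∈ cubeFam false θ.L c.a c.M c.ρ c.k j)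
              (fun q => hquot i.1.η β len (1 : Site θ.D → Fin θ.D → θ.𝔸ˣ) (covDerivFwd i.1.η (1 : Site θ.D → Fin θ.D → θ.𝔸ˣ) q.1 (fun z => A' z q.2.1)) q.2.2)
            ≤ B₀β * (bondNorm θ.L c.k i.1.η (-(3 : ℝ)) (cubeFam false θ.L c.a c.M c.ρ c.k) (fun x μ => Jcur i.1.η (1 : Site θ.D → Fin θ.D → θ.𝔸ˣ) A' μ x)
              + wsup 1 (fun p : {p : ℕ × (Site θ.D × Fin θ.D) // p.1 ≤ c.k ∧ p.2 ∈ cubeLamB θ.L c.a c.M c.ρ c.k c.k p.1} =>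
                  linCovIter θ.L (1 : Site θ.D → Fin θ.D → θ.𝔸ˣ) (iEta i.1.η A') p.1.1 p.1.2.1 p.1.2.2))) ∧
      ∀ (U₀ : Site θ.D → Fin θ.D → θ.𝔸ˣ), (∀ x κ, U₀ x κ ∈ unitaryUnits θ.𝔸) → ∀ (α₀ : ℝ), 0 < α₀ → InAk θ.L i.1.k i.1.η α₀ i.1.Ω U₀ →
      ((∃ (v : Site θ.D → θ.𝔸ˣ) (lam : Site θ.D → θ.𝔸), (∀ x, v x ∈ unitaryUnits θ.𝔸) ∧ (∀ x, x ∉ (cubeFam false θ.L c.a c.M c.ρ c.k) 0 → v x = 1) ∧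
        (∀ j, j ≤ 1 → ∀ b ∈ {b : Site θ.D × Fin θ.D | SideTouches ((cubeFam false θ.L c.a c.M c.ρ c.k) j) b.1 b.2}, (v b.1 : θ.𝔸) = ((gaugeExp lam b.1 : θ.𝔸ˣ) : θ.𝔸) ∧
        (v (b.1 + e b.2) : θ.𝔸) = ((gaugeExp lam (b.1 + e b.2) : θ.𝔸ˣ) : θ.𝔸)) ∧
        (∀ j, j ≤ 1 → ∀ b ∈ {b : Site θ.D × Fin θ.D | SideTouches ((cubeFam false θ.L c.a c.M c.ρ c.k) j) b.1 b.2},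
        ‖lam b.1‖ ≤ (8 * B₀' * (5 * (θ.D : ℝ) * θ.L * B₀) * (((θ.L : ℝ) ^ 3 * α₀) + (6 * (θ.D : ℝ) * (θ.L : ℝ) ^ 2 * c.M * α₀))) ∧
          ((θ.L : ℝ) ^ j * i.1.η) * ‖covDerivFwd i.1.η (1 : Site θ.D → Fin θ.D →
          θ.𝔸ˣ) b.2 lam b.1‖ ≤ (8 * B₀' * (5 * (θ.D : ℝ) * θ.L * B₀) * (((θ.L : ℝ) ^ 3 * α₀) + (6 * (θ.D : ℝ) * (θ.L : ℝ) ^ 2 * c.M * α₀)))) ∧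
        IsLandau138W θ.L 1 i.1.η ((cubeFam false θ.L c.a c.M c.ρ c.k) 0) ((cubeLamS θ.L c.a c.M c.ρ c.k) 1) (1 : Site θ.D → Fin θ.D → θ.𝔸ˣ) (mgauge (1 : Site θ.D → Fin θ.D →
          θ.𝔸ˣ) v⁻¹ (cutFixed θ.L (tLo c.a c.ρ) (tHi c.a c.M c.ρ) U₀ c.k (ctr c.a c.M))) ∧ Restr129 θ.L 1 ((cubeLamS θ.L c.a c.M c.ρ c.k) 1) (1 : Site θ.D → Fin θ.D → θ.𝔸ˣ) ((1 : Site θ.D →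
          θ.𝔸ˣ) * v))) ∧
      ((∀ m, 1 ≤ m → m < c.k → ∀ (u₁ : Site θ.D → θ.𝔸ˣ) (U₁ : Site θ.D → Fin θ.D → θ.𝔸ˣ) (A : Site θ.D → Fin θ.D → θ.𝔸),
        (∀ x, u₁ x ∈ unitaryUnits θ.𝔸) → (∀ x, x ∉ (cubeFam false θ.L c.a c.M c.ρ c.k) 0 → u₁ x = 1) → mgauge (1 : Site θ.D → Fin θ.D →
          θ.𝔸ˣ) u₁ U₁ = (cutFixed θ.L (tLo c.a c.ρ) (tHi c.a c.M c.ρ) U₀ c.k (ctr c.a c.M)) → Restr129 θ.L m ((cubeLamS θ.L c.a c.M c.ρ c.k) m) (1 : Site θ.D → Fin θ.D → θ.𝔸ˣ) u₁ →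
        IsLandau138W θ.L m i.1.η ((cubeFam false θ.L c.a c.M c.ρ c.k) 0) ((cubeLamS θ.L c.a c.M c.ρ c.k) m) (1 : Site θ.D → Fin θ.D → θ.𝔸ˣ) U₁ →
        (∀ j, j ≤ m → ∀ b ∈ {b : Site θ.D × Fin θ.D | SideTouches ((cubeFam false θ.L c.a c.M c.ρ c.k) j) b.1 b.2},
        U₁ b.1 b.2 = cfgExp i.1.η A b.1 b.2 ∧ IsSelfAdjoint (A b.1 b.2) ∧
          ‖A b.1 b.2‖ ≤ (5 * (θ.D : ℝ) * θ.L * B₀ * (((θ.L : ℝ) ^ 3 * α₀) + (6 * (θ.D : ℝ) * (θ.L : ℝ) ^ 2 * c.M * α₀))) * ((θ.L : ℝ) ^ j * i.1.η)⁻¹) →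
        ∃ (v : Site θ.D → θ.𝔸ˣ) (lam : Site θ.D → θ.𝔸), (∀ x, v x ∈ unitaryUnits θ.𝔸) ∧ (∀ x, x ∉ (cubeFam false θ.L c.a c.M c.ρ c.k) 0 → v x = 1) ∧
        (∀ j, j ≤ m + 1 →
          ∀ b ∈ {b : Site θ.D × Fin θ.D | SideTouches ((cubeFam false θ.L c.a c.M c.ρ c.k) j) b.1 b.2}, (v b.1 : θ.𝔸) = ((gaugeExp lam b.1 : θ.𝔸ˣ) : θ.𝔸) ∧
        (v (b.1 + e b.2) : θ.𝔸) = ((gaugeExp lam (b.1 + e b.2) : θ.𝔸ˣ) : θ.𝔸)) ∧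
        (∀ j, j ≤ m + 1 → ∀ b ∈ {b : Site θ.D × Fin θ.D | SideTouches ((cubeFam false θ.L c.a c.M c.ρ c.k) j) b.1 b.2},
        ‖lam b.1‖ ≤ (8 * B₀' * (5 * (θ.D : ℝ) * θ.L * B₀) * (((θ.L : ℝ) ^ 3 * α₀) + (6 * (θ.D : ℝ) * (θ.L : ℝ) ^ 2 * c.M * α₀))) ∧
          ((θ.L : ℝ) ^ j * i.1.η) * ‖covDerivFwd i.1.η (1 : Site θ.D → Fin θ.D →
          θ.𝔸ˣ) b.2 lam b.1‖ ≤ (8 * B₀' * (5 * (θ.D : ℝ) * θ.L * B₀) * (((θ.L : ℝ) ^ 3 * α₀) + (6 * (θ.D : ℝ) * (θ.L : ℝ) ^ 2 * c.M * α₀)))) ∧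
        IsLandau138W θ.L (m + 1) i.1.η ((cubeFam false θ.L c.a c.M c.ρ c.k) 0) ((cubeLamS θ.L c.a c.M c.ρ c.k) (m + 1)) (1 : Site θ.D → Fin θ.D → θ.𝔸ˣ) (mgauge (1 : Site θ.D → Fin θ.D →
          θ.𝔸ˣ) v⁻¹ U₁) ∧ Restr129 θ.L (m + 1) ((cubeLamS θ.L c.a c.M c.ρ c.k) (m + 1)) (1 : Site θ.D → Fin θ.D → θ.𝔸ˣ) (u₁ * v))) ∧
      ((∀ m, 1 ≤ m → m ≤ c.k → ∀ (u : Site θ.D → θ.𝔸ˣ) (W : Site θ.D → Fin θ.D → θ.𝔸ˣ) (A' : Site θ.D → Fin θ.D → θ.𝔸),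
        (∀ x, u x ∈ unitaryUnits θ.𝔸) → mgauge (1 : Site θ.D → Fin θ.D → θ.𝔸ˣ) u W = (cutFixed θ.L (tLo c.a c.ρ) (tHi c.a c.M c.ρ) U₀ c.k (ctr c.a c.M)) →
          Restr129 θ.L m ((cubeLamS θ.L c.a c.M c.ρ c.k) m) (1 : Site θ.D → Fin θ.D → θ.𝔸ˣ) u →
          IsLandau138W θ.L m i.1.η ((cubeFam false θ.L c.a c.M c.ρ c.k) 0) ((cubeLamS θ.L c.a c.M c.ρ c.k) m) (1 : Site θ.D → Fin θ.D → θ.𝔸ˣ) W →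
        (∀ y τ, IsSelfAdjoint (A' y τ)) →
        (∀ j, j ≤ m → ∀ y τ, SideTouches ((cubeFam false θ.L c.a c.M c.ρ c.k) j) y τ →
        W y τ = cfgExp i.1.η A' y τ ∧
          ‖A' y τ‖ ≤ (2 * (θ.L * (5 * (θ.D : ℝ) * θ.L * B₀ * (((θ.L : ℝ) ^ 3 * α₀) + (6 * (θ.D : ℝ) * (θ.L : ℝ) ^ 2 * c.M * α₀)))) + 8 * (8 * B₀' * (5 * (θ.D : ℝ) * θ.L * B₀) * (((θ.L : ℝ) ^ 3 * α₀) + (6 * (θ.D : ℝ) * (θ.L : ℝ) ^ 2 * c.M * α₀)))) * ((θ.L : ℝ) ^ j * i.1.η)⁻¹) →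
        (∀ y τ, (∀ j, j ≤ m → ¬ SideTouches ((cubeFam false θ.L c.a c.M c.ρ c.k) j) y τ) → A' y τ = 0) →
        msup θ.L m i.1.η (-(1 : ℝ)) (fun j (b : Site θ.D × Fin θ.D) => SideTouches ((cubeFam false θ.L c.a c.M c.ρ c.k) j) b.1 b.2) (fun b => A' b.1 b.2)
        ≤ B₀ * (bondNorm θ.L m i.1.η (-(3 : ℝ)) (cubeFam false θ.L c.a c.M c.ρ c.k) (fun x μ => Jcur i.1.η (1 : Site θ.D → Fin θ.D → θ.𝔸ˣ) A' μ x)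
        + wsup 1 (fun p : {p : ℕ × (Site θ.D × Fin θ.D) // p.1 ≤ m ∧ p.2 ∈ (cubeLamB θ.L c.a c.M c.ρ c.k) m p.1} =>
        linCovIter θ.L (1 : Site θ.D → Fin θ.D → θ.𝔸ˣ) (iEta i.1.η A') p.1.1 p.1.2.1 p.1.2.2)) ∧
        msup θ.L m i.1.η (-(2 : ℝ)) (fun j (t : Fin θ.D × Fin θ.D × Site θ.D) => SideTouches ((cubeFam false θ.L c.a c.M c.ρ c.k) j) t.2.2 t.2.1)
        (fun t => covDerivFwd i.1.η (1 : Site θ.D → Fin θ.D → θ.𝔸ˣ) t.1 (fun z => A' z t.2.1) t.2.2)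
        ≤ B₀ * (bondNorm θ.L m i.1.η (-(3 : ℝ)) (cubeFam false θ.L c.a c.M c.ρ c.k) (fun x μ => Jcur i.1.η (1 : Site θ.D → Fin θ.D → θ.𝔸ˣ) A' μ x)
        + wsup 1 (fun p : {p : ℕ × (Site θ.D × Fin θ.D) // p.1 ≤ m ∧ p.2 ∈ (cubeLamB θ.L c.a c.M c.ρ c.k) m p.1} =>
        linCovIter θ.L (1 : Site θ.D → Fin θ.D → θ.𝔸ˣ) (iEta i.1.η A') p.1.1 p.1.2.1 p.1.2.2))))) →
      B8.Prop6Printed θ.D (θ.L : ℝ) (5 * (θ.D : ℝ) * θ.L * B₀) c₁ (Node00.cubB8OfRecord θ)) := by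
  obtain ⟨c₁, hc₁, G⟩ := prop6Printed_zdCub_flat₃ (𝔸 := θ.𝔸) hD θ.two_le_L hB₀ hB₀' hB hB₀β hC₂ hcB9 β len
  exact ⟨c₁, hc₁, fun S => G (fun i : Node00.IdxB8 θ => i.1) S⟩

#print axioms gaugedBoundB8_cubeMember_flat₃
#print axioms prop6Printed_zdCub_flat₃
#print axioms prop6Printed_cubB8OfRecord_flat₃

end Literature.MathematicalPhysics.QuantumFieldTheory.Balaban1983to89.B8Prop6CubeMemberGaugedFlat

end
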